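import Literature.MathematicalPhysics.QuantumFieldTheory.Volkov2020.AbsoluteConvergence
import Literature.MathematicalPhysics.QuantumFieldTheory.Volkov2020.SpeerFormHalf
import HarnessLib

/-!
# Volkov 2020 (NPB 961, 115232): **THEOREM 3.1 ⟹ ABSOLUTE CONVERGENCE OF THE FEYNMAN PARAMETRIC INTEGRAL (1.7)** as ONE kernel theorem — the displayed bound of Theorem 3.1, read as a hypothesis on the integrand `I′` in every Hepp sector with any exponents `≥ ½`, implies that `I′ δ(z₁+…+z_L−1)` is absolutely integrable over `{z₁,…,z_L > 0}` (B.21's «Theorem 3.1 ⇒ (1.9)» and B.32/B.35's «(1.9) ⇒ convergence» composed; the sector variables `t_l = z_{j_l}/z_{j_{l−1}}` built from the sorting permutation of the point)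

independent recomputation; certified where stated, statistical where stated; no new-physics claim.

CITATION HEADER (venture `QEDPrecision`, cell `pub-qed`, track TROPICAL seat V3b = `pub-qed-trop-v3-lit-2` gen 12; VALUE-FREE: one inequality
between two printed majorants and one integrability statement — no Feynman integrand of the cell, nothing per word). Composes
`Volkov2020.SpeerFormHalf` (B.21: «Theorem 3.1 ⇒ (1.9)» as the shape `C·∏ t_l^{d_l}/P ≤ C·√L·z_min^{1/2}/P`, `thm31_to_eq19`) with
`Volkov2020.AbsoluteConvergence` (B.32/B.35: «(1.9) ⇒ absolute convergence» on the whole simplex, `integrableOn_simplexChart_of_abs_le_eq19Majorant`)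
and V3a's `Volkov2017.WholeSimplexIntegral` (`simplexChart`, `simplexPoint`, `sectorPerm`, `antitone_comp_sectorPerm`): the missing glue was
the passage from a POINT of the simplex to ITS sector variables (sorting permutation, ratios t_l, telescoping, min = last parameter). Serves
§B.43 of `tropical/view/V3-VOLKOV-DEGREES.md` (B.33's rows «Theorem 3.1 ⟹ (1.9)» and «(1.9) ⟹ absolute convergence» become ONE kernel arrow).

Source. [Volkov2020] S. Volkov, "Infrared and ultraviolet power counting on the mass shell in quantum electrodynamics", Nucl. Phys. B 961
(2020) 115232 = arXiv:1912.04885v4 (e-print tex `iclos_arxiv.tex`, sha256 8613757ca2360833…, held by the cell under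
`pub-qed-trop-v3-lit-2/sources/arxiv-1912.04885/`; numbering by section = the journal's), VERBATIM:
* §1 eqs. (1.6)–(1.7) (journal p.4; tex l.85–96): "z_{j₁} ≥ z_{j₂} ≥ … ≥ z_{j_L} (1.6) … ∫_{z₁,…,z_L>0} I′(z₁,…,z_L) δ(z₁+…+z_L−1) dz₁…dz_L (1.7)".
* §1 eq. (1.9) and after (journal p.5; tex l.116–119): "|I′(z₁,…,z_n)| ≤ C·(min(z₁,…,z_n))^{1/2}/(z₁z₂…z_n) (1.9) … This leads to the
  absolute convergence of the Feynman parametric integral."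
* §3.1 (journal p.10; tex l.296–302): "t₁ = z_{j₁}, t₂ = z_{j₂}/z_{j₁}, …, t_L = z_{j_L}/z_{j_{L−1}} … Therefore, t₁,…,t_L ≤ 1."
* **Theorem 3.1** (journal p.17; tex l.572–576): "For the Feynman parametric integrand I′(z₁,…,z_L) we have
  |I′(z₁,…,z_L)| ≤ C·∏_{l=2}^{L} t_l^{max(⌈−ω(IClos(s^{[l]}))⌉ − 1/2, 1/2)}/(z₁…z_L), where C is some constant depending only on the structure
  of the graph. Let us remark that we ignore the multiplier containing t₁ (because we use the Feynman parameters, 1/L ≤ t₁ ≤ 1)."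

READING. `L = m + 2 ≥ 2` lines; the domain of (1.7) with δ resolved in z₁ is V3a's `simplexChart m` (points `simplexPoint x = (1 − Σx, x)`);
a Hepp sector = an ordering σ : Perm(Fin L) with `z ∘ σ` decreasing (`Antitone`), Volkov's (j₁,…,j_L) = (σ 0,…,σ (L−1)); the sector variables
t_{l} (l ≥ 2) = `sectorRatio σ z` (t₁ = z_{j₁} is not a variable of the bound, as printed); Theorem 3.1's right-hand side = `thm31Bound C d σ z`
with the exponents `d σ l` left as ANY real family ≥ ½ (the printed max(⌈−ω(IClos(s^{[l]}))⌉ − ½, ½) qualifies whatever the integers are: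
`integrableOn_of_thm31_printed`); «Theorem 3.1 holds for I′» = `Thm31Holds I′ C d` := the bound in every sector at every point of the open
simplex. Measurability of I′ on the chart is a hypothesis (the paper's I′ is a rational function times a power; not modelled).

WHAT THE KERNEL CERTIFIES (all PROVED; Mathlib + B.21 + B.32/B.35 + V3a only; no named fact, D-0026 net debt 0):
* §1 `sectorRatio` (= t_l AS PRINTED, l ≥ 2), `thm31Bound`, `Thm31Holds`.
* §2 `sectorRatio_pos`, `sectorRatio_le_one` («t_l ≤ 1»), `le_first_of_antitone` / `last_le_of_antitone` (z_{j₁} = max, z_{j_L} = min),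
  `inf'_eq_last_of_antitone` (min(z) = z_{j_L}), **`prod_sectorRatio`: ∏_{l≥2} t_l = z_{j_L}/z_{j₁}** (telescoping, via B.21's `prod_ratio_telescope`).
* §3 **`thm31Bound_le_eq19Majorant`: Theorem 3.1's right-hand side ≤ C·√L·(min z)^{1/2}/(z₁⋯z_L)** in every sector at every point of the open
  simplex (d ≥ ½, C ≥ 0); **`abs_le_eq19Majorant_of_thm31`**: an integrand obeying Theorem 3.1 obeys (1.9) with constant C√L (each point read in
  the sector of its decreasing rearrangement `sectorPerm z`).
* §4 **`integrableOn_of_thm31`: Theorem 3.1's bound (any C ≥ 0, any exponents ≥ ½) ⟹ `I′ ∘ simplexPoint` is integrable on `simplexChart` —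
  (1.7) converges absolutely**; `integrableOn_of_thm31_printed` (the printed exponent shape max(e − ½, ½) for any family e);
  `integrableOn_of_thm31_literal` (the literal domain {x > 0, Σx < 1} and point (1 − Σx, x)).
* §5 `thm31Holds_eq19Majorant`: the (1.9) majorant itself satisfies Theorem 3.1's bound with C = 1 and all d_l = ½ (non-vacuity; with §4 this
  recovers B.35's integrability of the majorant).
NOT claimed: Theorem 3.1 itself (that the magnetic-moment integrand I′ of §2.2 satisfies the bound — its proof's kernel pieces are B.27–B.31,
B.37–B.42 and p382596, modulo §2.2's derivation and 𝒫 as a functional); square-integrability / variance (nothing in NPB 961 bears on it, B.8);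
measurability of the actual I′; anything per word of the cell.
-/

namespace Literature.MathematicalPhysics.QuantumFieldTheory.Volkov2020

open MeasureTheory Finset Real
open Volkov2017

noncomputable section

variable {m : ℕ}

/-! ## §1 Theorem 3.1's right-hand side as a function of the point and of the sector -/

/-- **The sector variables of §3.1 AS PRINTED**, for the ordering `σ` (Volkov's (j₁,…,j_L) = (σ 0, …, σ (L−1))): `t_{l+2} = z_{j_{l+2}}/z_{j_{l+1}}`,
`l = 0,…,L−2` — «t₁ = z_{j₁}, t₂ = z_{j₂}/z_{j₁}, …, t_L = z_{j_L}/z_{j_{L−1}}» without `t₁` («we ignore the multiplier containing t₁»).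
[cite: Volkov2020, §3.1 (journal p.10; arXiv:1912.04885v4 tex l.296–302); Theorem 3.1, closing remark (journal p.17; tex l.575)] -/
def sectorRatio (σ : Equiv.Perm (Fin (m + 2))) (z : Fin (m + 2) → ℝ) (l : Fin (m + 1)) : ℝ :=
  z (σ l.succ) / z (σ (Fin.castSucc l))

/-- **The right-hand side of Theorem 3.1**: `C · ∏_{l=2}^{L} t_l^{d_l} / (z₁⋯z_L)` with per-sector exponents `d σ l` (printed:
`d_l = max(⌈−ω(IClos(s^{[l]}))⌉ − ½, ½)`, which depends on the sector through `s^{[l]} = {j_l,…,j_L}`).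
[cite: Volkov2020, Theorem 3.1 (journal p.17; arXiv:1912.04885v4 tex l.572–576)] -/
def thm31Bound (C : ℝ) (d : Equiv.Perm (Fin (m + 2)) → Fin (m + 1) → ℝ) (σ : Equiv.Perm (Fin (m + 2)))
    (z : Fin (m + 2) → ℝ) : ℝ :=
  C * (∏ l, sectorRatio σ z l ^ d σ l) / ∏ j, z j

/-- **«Theorem 3.1 holds for I′»** as a hypothesis: in every Hepp sector — every ordering `σ` with `z_{σ(0)} ≥ z_{σ(1)} ≥ … ≥ z_{σ(L−1)}` — of the open
simplex `{z > 0, Σ z = 1}`, `|I′(z)| ≤ C · ∏_{l=2}^{L} t_l^{d_l}/(z₁⋯z_L)`. [cite: Volkov2020, Theorem 3.1 «For the Feynman parametric integrand I′(z₁,…,z_L) we have |I′(z₁,…,z_L)| ≤ C·∏_{l=2}^{L} t_l^{max(⌈−ω(IClos(s^{[l]}))⌉ − ½, ½)}/(z₁…z_L), where C is some constant depending only on the structure of the graph» (journal p.17; arXiv:1912.04885v4 tex l.572–576)] -/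
def Thm31Holds (I' : (Fin (m + 2) → ℝ) → ℝ) (C : ℝ) (d : Equiv.Perm (Fin (m + 2)) → Fin (m + 1) → ℝ) : Prop :=
  ∀ (σ : Equiv.Perm (Fin (m + 2))) (z : Fin (m + 2) → ℝ), (∀ j, 0 < z j) → ∑ j, z j = 1 → Antitone (z ∘ ⇑σ) →
    |I' z| ≤ thm31Bound C d σ z

/-! ## §2 In a sector: the ratios lie in (0,1], telescope to z_min/z_max, and the minimum is the last parameter -/

section Sector

variable {σ : Equiv.Perm (Fin (m + 2))} {z : Fin (m + 2) → ℝ}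

/-- `t_l > 0` on the open simplex. [cite: Volkov2020, §3.1 (journal p.10; arXiv:1912.04885v4 tex l.296–302)] -/
theorem sectorRatio_pos (hz : ∀ j, 0 < z j) (l : Fin (m + 1)) : 0 < sectorRatio σ z l :=
  div_pos (hz _) (hz _)

/-- «Therefore, t₁,…,t_L ≤ 1» in the sector. [cite: Volkov2020, §3.1 (journal p.10; arXiv:1912.04885v4 tex l.300–302)] -/
theorem sectorRatio_le_one (hz : ∀ j, 0 < z j) (hσ : Antitone (z ∘ ⇑σ)) (l : Fin (m + 1)) : sectorRatio σ z l ≤ 1 := by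
  unfold sectorRatio
  rw [div_le_one (hz _)]
  exact hσ (Fin.castSucc_lt_succ (i := l)).le

/-- In the sector every parameter is at most the first one, `z_{j₁} = max z`. [cite: Volkov2020, §1 eq. (1.6) (journal p.4; arXiv:1912.04885v4 tex l.86–88)] -/
theorem le_first_of_antitone (hσ : Antitone (z ∘ ⇑σ)) (i : Fin (m + 2)) : z i ≤ z (σ 0) := by
  have h := hσ (Fin.zero_le (σ.symm i))
  simpa using h

/-- … and at least the last one, `z_{j_L} = min z`. [cite: Volkov2020, §1 eq. (1.6) (journal p.4; arXiv:1912.04885v4 tex l.86–88)] -/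
theorem last_le_of_antitone (hσ : Antitone (z ∘ ⇑σ)) (i : Fin (m + 2)) : z (σ (Fin.last (m + 1))) ≤ z i := by
  have h := hσ (Fin.le_last (σ.symm i))
  simpa using h

/-- In the sector the minimum of the parameters is the last one: `min(z₁,…,z_L) = z_{j_L}`. [cite: Volkov2020, §1 eqs. (1.6), (1.9) (journal p.4–5)] -/
theorem inf'_eq_last_of_antitone (hσ : Antitone (z ∘ ⇑σ)) :
    univ.inf' univ_nonempty z = z (σ (Fin.last (m + 1))) :=
  le_antisymm (inf'_le z (mem_univ _)) (le_inf' _ _ fun i _ => last_le_of_antitone hσ i)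

/-- **The ratios telescope**: `∏_{l=2}^{L} t_l = z_{j_L}/z_{j₁}` ( = min z / max z). [cite: Volkov2020, §3.1 «z_{j_l} = t₁t₂…t_l» (journal p.10–11; arXiv:1912.04885v4 tex l.296–312)] -/
theorem prod_sectorRatio (hz : ∀ j, 0 < z j) :
    ∏ l, sectorRatio σ z l = z (σ (Fin.last (m + 1))) / z (σ 0) := by
  set w : ℕ → ℝ := fun i => if h : i < m + 2 then z (σ ⟨i, h⟩) else 1 with hw
  have hwne : ∀ i, w i ≠ 0 := by
    intro i
    simp only [hw]
    split_ifs with h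
    · exact (hz _).ne'
    · exact one_ne_zero
  have hterm : ∀ l : Fin (m + 1), sectorRatio σ z l = w ((l : ℕ) + 1) / w l := by
    intro l
    have h1 : (l : ℕ) + 1 < m + 2 := by omega
    have h2 : (l : ℕ) < m + 2 := by omega
    simp only [sectorRatio, hw, dif_pos h1, dif_pos h2]
    rfl
  calc ∏ l, sectorRatio σ z l = ∏ l : Fin (m + 1), w ((l : ℕ) + 1) / w l := prod_congr rfl fun l _ => hterm l
    _ = ∏ i ∈ range (m + 1), w (i + 1) / w i := Fin.prod_univ_eq_prod_range (fun i => w (i + 1) / w i) (m + 1)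
    _ = w (m + 1) / w 0 := prod_ratio_telescope w hwne (m + 1)
    _ = z (σ (Fin.last (m + 1))) / z (σ 0) := by
        simp only [hw, dif_pos (show m + 1 < m + 2 by omega), dif_pos (show 0 < m + 2 by omega)]
        rfl

end Sector

/-! ## §3 Theorem 3.1's bound is below (1.9)'s, with C ↦ C·√L -/

/-- **Theorem 3.1's right-hand side ≤ C·√L · (min z)^{1/2}/(z₁⋯z_L)** at every point of the open simplex read in its own sector, for any
exponents `d_l ≥ ½` and `C ≥ 0` (B.21's `thm31_to_eq19` fed with the sector variables of the point).
[cite: Volkov2020, Theorem 3.1 ⇒ eq. (1.9) (journal p.17, p.5; arXiv:1912.04885v4 tex l.572–576, l.116–118)] -/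
theorem thm31Bound_le_eq19Majorant {C : ℝ} (hC : 0 ≤ C) {d : Equiv.Perm (Fin (m + 2)) → Fin (m + 1) → ℝ}
    (hd : ∀ σ l, 1 / 2 ≤ d σ l) {σ : Equiv.Perm (Fin (m + 2))} {z : Fin (m + 2) → ℝ} (hz : ∀ j, 0 < z j)
    (hsum : ∑ j, z j = 1) (hσ : Antitone (z ∘ ⇑σ)) :
    thm31Bound C d σ z ≤ C * ((m + 2 : ℕ) : ℝ) ^ (1 / 2 : ℝ) * eq19Majorant z := by
  have hP : 0 < ∏ j, z j := prod_pos fun j _ => hz j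
  have h := thm31_to_eq19 univ (sectorRatio σ z) (d σ) (fun l _ => sectorRatio_pos hz l)
    (fun l _ => sectorRatio_le_one hz hσ l) (fun l _ => hd σ l) (show 0 < m + 2 by omega) z hsum
    (z (σ 0)) (z (σ (Fin.last (m + 1)))) (le_first_of_antitone hσ) (hz _).le (prod_sectorRatio hz) C (∏ j, z j) hC hP
  unfold thm31Bound eq19Majorant
  rw [inf'_eq_last_of_antitone hσ]
  calc C * (∏ l, sectorRatio σ z l ^ d σ l) / ∏ j, z j
      ≤ C * ((m + 2 : ℕ) : ℝ) ^ (1 / 2 : ℝ) * z (σ (Fin.last (m + 1))) ^ (1 / 2 : ℝ) / ∏ j, z j := h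
    _ = C * ((m + 2 : ℕ) : ℝ) ^ (1 / 2 : ℝ) * (z (σ (Fin.last (m + 1))) ^ (1 / 2 : ℝ) / ∏ j, z j) := by ring

/-- Hence **an integrand obeying Theorem 3.1 obeys (1.9)** with the constant `C·√L`, at every point of the open simplex `{z > 0, Σ z = 1}`
(read in the sector of its decreasing rearrangement, V3a's `sectorPerm`). [cite: Volkov2020, Theorem 3.1 ⇒ eq. (1.9) «|I′(z₁,…,z_n)| ≤ C·(min(z₁,…,z_n))^{1/2}/(z₁z₂…z_n)» (journal p.17, p.5; arXiv:1912.04885v4 tex l.572–576, l.116–118)] -/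
theorem abs_le_eq19Majorant_of_thm31 {I' : (Fin (m + 2) → ℝ) → ℝ} {C : ℝ} (hC : 0 ≤ C)
    {d : Equiv.Perm (Fin (m + 2)) → Fin (m + 1) → ℝ} (hd : ∀ σ l, 1 / 2 ≤ d σ l) (h31 : Thm31Holds I' C d)
    {z : Fin (m + 2) → ℝ} (hz : ∀ j, 0 < z j) (hsum : ∑ j, z j = 1) :
    |I' z| ≤ C * ((m + 2 : ℕ) : ℝ) ^ (1 / 2 : ℝ) * eq19Majorant z :=
  (h31 (sectorPerm z) z hz hsum (antitone_comp_sectorPerm z)).trans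
    (thm31Bound_le_eq19Majorant hC hd hz hsum (antitone_comp_sectorPerm z))

/-! ## §4 Theorem 3.1 ⟹ the Feynman parametric integral (1.7) converges absolutely -/

/-- **THEOREM 3.1 ⟹ ABSOLUTE CONVERGENCE OF (1.7).** If an (a.e.-strongly measurable) integrand `I′` satisfies the displayed bound of Theorem 3.1
in every Hepp sector of the open simplex, with any constant `C ≥ 0` and any exponents `d_l ≥ ½`, then `∫_{z₁,…,z_L>0} I′ δ(z₁+…+z_L−1) dz`
converges absolutely — `I′ ∘ simplexPoint` is integrable on V3a's `simplexChart` (the `δ` resolved in `z₁`). This is the paper's finite-MEAN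
conclusion «This leads to the absolute convergence of the Feynman parametric integral» drawn from Theorem 3.1 itself.
[cite: Volkov2020, Theorem 3.1 (journal p.17; tex l.572–576) with §1 eq. (1.7), (1.9) and the sentence after (1.9) (journal p.4–5; arXiv:1912.04885v4 tex l.94–96, l.116–119)] -/
theorem integrableOn_of_thm31 {I' : (Fin (m + 2) → ℝ) → ℝ} {C : ℝ} (hC : 0 ≤ C)
    {d : Equiv.Perm (Fin (m + 2)) → Fin (m + 1) → ℝ} (hd : ∀ σ l, 1 / 2 ≤ d σ l) (h31 : Thm31Holds I' C d)
    (hmeas : AEStronglyMeasurable (fun x : Fin (m + 1) → ℝ => I' (simplexPoint x)) (volume.restrict (simplexChart m))) :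
    IntegrableOn (fun x : Fin (m + 1) → ℝ => I' (simplexPoint x)) (simplexChart m) :=
  integrableOn_simplexChart_of_abs_le_eq19Majorant hmeas fun x hx =>
    abs_le_eq19Majorant_of_thm31 hC hd h31 hx (sum_simplexPoint x)

/-- **The printed exponents qualify**: with `d_l = max(e_l − ½, ½)` for ANY real family `e` (printed: `e_l = ⌈−ω(IClos(s^{[l]}))⌉`, an
integer depending on the sector), Theorem 3.1's bound implies absolute convergence — no sign condition on `ω` is needed for this
implication (the content of Theorem 3.1 is that such a bound HOLDS). [cite: Volkov2020, Theorem 3.1 «t_l^{max(⌈−ω(IClos(s^{[l]}))⌉ − 1/2, 1/2)}» (journal p.17; arXiv:1912.04885v4 tex l.572–576) and §1 after (1.9) (journal p.5; tex l.119)] -/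
theorem integrableOn_of_thm31_printed {I' : (Fin (m + 2) → ℝ) → ℝ} {C : ℝ} (hC : 0 ≤ C)
    (e : Equiv.Perm (Fin (m + 2)) → Fin (m + 1) → ℝ)
    (h31 : Thm31Holds I' C fun σ l => max (e σ l - 1 / 2) (1 / 2))
    (hmeas : AEStronglyMeasurable (fun x : Fin (m + 1) → ℝ => I' (simplexPoint x)) (volume.restrict (simplexChart m))) :
    IntegrableOn (fun x : Fin (m + 1) → ℝ => I' (simplexPoint x)) (simplexChart m) :=
  integrableOn_of_thm31 hC (fun σ l => thm31_exponent_ge_half (e σ l)) h31 hmeas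

/-- The same over the literal domain `{x | x > 0, Σ x < 1}` with the literal simplex point `(1 − Σx, x)` — (1.7) with `δ(z₁+…+z_L−1)`
resolved in `z₁`. [cite: Volkov2020, §1 eq. (1.7) (journal p.4; arXiv:1912.04885v4 tex l.94–96) and Theorem 3.1 (journal p.17)] -/
theorem integrableOn_of_thm31_literal {I' : (Fin (m + 2) → ℝ) → ℝ} {C : ℝ} (hC : 0 ≤ C)
    {d : Equiv.Perm (Fin (m + 2)) → Fin (m + 1) → ℝ} (hd : ∀ σ l, 1 / 2 ≤ d σ l) (h31 : Thm31Holds I' C d)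
    (hmeas : AEStronglyMeasurable (fun x : Fin (m + 1) → ℝ => I' (Fin.cons (1 - ∑ i, x i) x))
      (volume.restrict {x : Fin (m + 1) → ℝ | (∀ i, 0 < x i) ∧ ∑ i, x i < 1})) :
    IntegrableOn (fun x : Fin (m + 1) → ℝ => I' (Fin.cons (1 - ∑ i, x i) x))
      {x : Fin (m + 1) → ℝ | (∀ i, 0 < x i) ∧ ∑ i, x i < 1} := by
  have hset : {x : Fin (m + 1) → ℝ | (∀ i, 0 < x i) ∧ ∑ i, x i < 1} = simplexChart m :=
    Set.ext fun _ => mem_simplexChart_iff.symm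
  rw [hset] at hmeas ⊢
  exact integrableOn_of_thm31 hC hd h31 hmeas

/-! ## §5 Non-vacuity: the majorant itself satisfies Theorem 3.1's bound with all exponents ½ -/

/-- The (1.9) majorant `(min z)^{1/2}/∏ z` obeys Theorem 3.1's bound with `C = 1` and every `d_l = ½` (in each sector
`∏_{l≥2} t_l^{1/2} = (z_{j_L}/z_{j₁})^{1/2} ≥ (min z)^{1/2}` since `z_{j₁} ≤ 1` on the simplex), so `Thm31Holds` is inhabited by a
nonzero integrand and `integrableOn_of_thm31` recovers B.35's `integrableOn_eq19Majorant_simplexChart`.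
[cite: Volkov2020, §1 eq. (1.9) and Theorem 3.1 (journal p.5, p.17)] -/
theorem thm31Holds_eq19Majorant :
    Thm31Holds (m := m) eq19Majorant 1 (fun _ _ => 1 / 2) := by
  intro σ z hz hsum hσ
  have hP : 0 < ∏ j, z j := prod_pos fun j _ => hz j
  have hmin : 0 < z (σ (Fin.last (m + 1))) := hz _
  have hmax : 0 < z (σ 0) := hz _
  have hmax1 : z (σ 0) ≤ 1 := by
    calc z (σ 0) = ∑ j ∈ {σ 0}, z j := by rw [sum_singleton]
      _ ≤ ∑ j, z j := sum_le_sum_of_subset_of_nonneg (subset_univ _) fun j _ _ => (hz j).le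
      _ = 1 := hsum
  have hnn : 0 ≤ eq19Majorant z := by
    unfold eq19Majorant
    rw [inf'_eq_last_of_antitone hσ]
    exact div_nonneg (rpow_nonneg hmin.le _) hP.le
  rw [abs_of_nonneg hnn]
  unfold thm31Bound eq19Majorant
  rw [inf'_eq_last_of_antitone hσ, one_mul]
  refine div_le_div_of_nonneg_right ?_ hP.le
  rw [Real.finsetProd_rpow _ _ (fun l _ => (sectorRatio_pos hz l).le), prod_sectorRatio hz]
  refine Real.rpow_le_rpow hmin.le ?_ (by norm_num)
  rw [le_div_iff₀ hmax]
  calc z (σ (Fin.last (m + 1))) * z (σ 0) ≤ z (σ (Fin.last (m + 1))) * 1 := mul_le_mul_of_nonneg_left hmax1 hmin.le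
    _ = z (σ (Fin.last (m + 1))) := mul_one _

end

end Literature.MathematicalPhysics.QuantumFieldTheory.Volkov2020
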